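import Mathlib
import Literature.NumberTheory.Irrationality.DirichletLValues.ChowlaMilnorOddEvenSplitProofs
import HarnessLib

/-!
# «`i√q` lies in the `ℚ`-linear space generated by the `Z_k(a,q)`»: the imaginary part of `ℚ(ζ_q)` and the
# engine of Gun–Murty–Rath's Proposition 3 (Canad. J. Math. 63 (2011), pp. 1337–1338)

Topic `Literature/NumberTheory/Irrationality/DirichletLValues`. Proofs-only leaf (theorems only, no definition, no
named fact, no `sorry`; cell pub-zeta5, P1 g54), sequel of `ChowlaMilnorOddEvenSplitProofs.lean`.

## Source (read on the page)

S. Gun, M. R. Murty, P. Rath, *On a conjecture of Chowla and Milnor* [GunRammurtyRath2011], proof of Proposition 3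
(pp. 1337–1338): for odd `k` and `(a,q) = 1`, `1 ≤ a < q/2`,
«`(ζ(k, a/q) − ζ(k, 1 − a/q))/(2πi)^k = (q^{k−1}/(2·k!)) Σ_b (ζ_q^{ab} − ζ_q^{−ab}) B_k(b/q)` … Thus the number `i√q`
lies in the `ℚ`-linear space generated by the real numbers [sic] `(ζ(k, a/q) − ζ(k, 1 − a/q))/(2πi)^k` with `(a, q) = 1`,
`1 ≤ a < q/2`. On the other hand, since `ζ(k)` is a rational multiple of `Σ_{(a,q)=1, a<q/2} (ζ(k, a/q) + ζ(k, 1 − a/q))`,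
we see that `ζ(k)/(2πi)^k` lies in the subspace generated by `(ζ(k, a/q) + ζ(k, 1 − a/q))/(2πi)^k` …. Thus the
Chowla–Milnor conjecture for the modulus `q` implies that `ζ(k)/(2πi)^k` and `i√q` lie in disjoint `ℚ`-spaces. Thus
their ratio is irrational and hence … `ζ(2d+1)/(π^{2d+1}√q) ∉ ℚ`», together with Proposition 1 (p. 1332–1334: the
`Z_k(a,q) = (ζ(k, a/q) − ζ(k, 1 − a/q))/(2πi)^k` lie in `ℚ(ζ_q)`, `Z_k(a,q)/i` is real, and by Okada's Lemma 1 they are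
`ℚ`-linearly independent).

## What is proved — the printed step WITHOUT Gauss sums, for EVERY purely imaginary element of `ℚ(ζ_q)`

The source obtains «`i√q ∈ Span_ℚ {Z_k(a,q)}`» from the Gauss sum of an odd quadratic character. Here the same
membership is proved for every `w ∈ ℚ(ζ_q)` with `w̄ = −w`, by a dimension count: the `φ(q)/2` numbers `Z_k(a,q)` are
`ℚ`-linearly independent (Okada), purely imaginary and in `ℚ(ζ_q)` (Proposition 1), while the `(−1)`-eigenspace `K⁻` of
complex conjugation on `ℚ(ζ_q)` has `ℚ`-dimension `≤ φ(q)/2` (`(u, v) ↦ u + ξv`, `ξ = Z_k(1,q) ≠ 0`, embeds `K⁻ × K⁻`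
into `ℚ(ζ_q)`, of dimension `φ(q)` by `cyclotomic_eq_minpoly_rat`); hence `Span_ℚ {Z_k(a,q)} = K⁻`.

* **`pi_pow_mul_mem_span_hurwitzEven_of_mul_I_mem_adjoin`** — for odd `k ≥ 3`, `q ≥ 3` and a real `t` with
  `t·i ∈ ℚ(e^{2πi/q})` (`Algebra.adjoin ℚ {exp (2πi/q)}`): `π^k · t ∈ V_k^+(q) = Span_ℚ {ζ(k, a/q) + (−1)^k ζ(k, 1 − a/q)}`
  (multiply `t·i = Σ c_a Z_k(a,q)` by `(2πi)^k = ±2^k π^k i`);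
* **`finrank_span_lt_totient_of_zetaValue_eq`** — THE ENGINE OF PROPOSITION 3: for odd `k ≥ 3`, `q ≥ 3`, `t` real with
  `t·i ∈ ℚ(e^{2πi/q})` and `ζ(k) ∈ ℚ·π^k·t`, the Chowla–Milnor conjecture FAILS at `(k, q)`: `dim_ℚ V_k(q) < φ(q)` — the
  coprime sum `J_k(q)ζ(k) = Σ_{(a,q)=1} ζ(k, a/q)` is a non-zero element of `V_k^+(q) ∩ V_k^−(q)`
  (`ChowlaMilnorOddEvenSplitProofs.finrank_span_lt_totient_of_mem_inf`). With `t = √q` this is the printed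
  «the Chowla–Milnor conjecture for the modulus `q` implies `ζ(2d+1)/(π^{2d+1}√q) ∉ ℚ`» (contrapositive); the input
  `i√N ∈ ℚ(ζ_{4N})` and Theorem 3 are assembled in the sequel files.

HONEST FRAMING (cells pub-zeta5 / zeta5-irr): kernel theorems of a printed proof step (in a Gauss-sum-free form) and
of the contrapositive of a printed CM-conditional implication; the Chowla–Milnor conjecture stays OPEN and untyped;
net named-fact debt 0; nothing here concerns `ζ(5)`.
-/

noncomputable section

open Finset Complex Polynomial

open scoped Nat

namespace Literature.NumberTheory.Irrationality.DirichletLValues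

open Literature.NumberTheory.Transcendental

/-! ### Small lemmas on `ℚ(ζ_q) = Algebra.adjoin ℚ {e^{2πi/q}}` -/

/-- `ℚ(e^{2πi/q})` is stable under complex conjugation: `ē^{2πi/q} = (e^{2πi/q})^{q−1}`. [folklore] -/
private theorem conj_mem_adjoin {q : ℕ} (hq : q ≠ 0) {z : ℂ}
    (hz : z ∈ Algebra.adjoin ℚ ({Complex.exp (2 * Real.pi * I / q)} : Set ℂ)) :
    starRingEnd ℂ z ∈ Algebra.adjoin ℚ ({Complex.exp (2 * Real.pi * I / q)} : Set ℂ) := by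
  set ζ := Complex.exp (2 * Real.pi * I / q) with hζ
  -- conjugation as a `ℚ`-algebra map
  let σ : ℂ →ₐ[ℚ] ℂ := (starRingEnd ℂ).toRatAlgHom
  have hσ : (Algebra.adjoin ℚ ({ζ} : Set ℂ)).map σ = Algebra.adjoin ℚ ({σ ζ} : Set ℂ) := by
    rw [AlgHom.map_adjoin_singleton]
  have hmem : σ z ∈ Algebra.adjoin ℚ ({σ ζ} : Set ℂ) := by
    rw [← hσ]
    exact Subalgebra.mem_map.2 ⟨z, hz, rfl⟩
  have hconjζ : σ ζ = ζ ^ (q - 1) := by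
    show starRingEnd ℂ ζ = ζ ^ (q - 1)
    have hζq : ζ ^ q = 1 := by
      rw [hζ]; exact (Complex.isPrimitiveRoot_exp q hq).pow_eq_one
    have hζ0 : ζ ≠ 0 := by rw [hζ]; exact Complex.exp_ne_zero _
    have h1 : starRingEnd ℂ ζ = ζ⁻¹ := by
      rw [hζ, ← Complex.exp_conj, ← Complex.exp_neg]
      congr 1
      simp only [map_div₀, map_mul, map_ofNat, Complex.conj_ofReal, Complex.conj_I, map_natCast]
      ring
    rw [h1, eq_comm, ← mul_inv_eq_one₀ (inv_ne_zero hζ0), inv_inv, ← pow_succ,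
      Nat.sub_add_cancel (Nat.one_le_iff_ne_zero.2 hq), hζq]
  have hle : Algebra.adjoin ℚ ({σ ζ} : Set ℂ) ≤ Algebra.adjoin ℚ ({ζ} : Set ℂ) := by
    refine Algebra.adjoin_le (Set.singleton_subset_iff.2 ?_)
    rw [hconjζ]
    exact Subalgebra.pow_mem _ (Algebra.subset_adjoin (Set.mem_singleton _)) _
  exact hle hmem

/-- `[ℚ(e^{2πi/q}) : ℚ] = φ(q)` and `ℚ(e^{2πi/q})` is finite-dimensional over `ℚ` (the minimal polynomial of `e^{2πi/q}`
is the cyclotomic polynomial). [folklore] -/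
private theorem finrank_adjoin_exp {q : ℕ} (hq : q ≠ 0) :
    Module.Finite ℚ ↥(Algebra.adjoin ℚ ({Complex.exp (2 * Real.pi * I / q)} : Set ℂ)) ∧
      Module.finrank ℚ ↥(Algebra.adjoin ℚ ({Complex.exp (2 * Real.pi * I / q)} : Set ℂ)) = Nat.totient q := by
  set ζ := Complex.exp (2 * Real.pi * I / q) with hζ
  have hprim : IsPrimitiveRoot ζ q := by rw [hζ]; exact Complex.isPrimitiveRoot_exp q hq
  have hint : IsIntegral ℚ ζ := (hprim.isIntegral (Nat.pos_of_ne_zero hq)).tower_top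
  let pb := Algebra.adjoin.powerBasis hint
  refine ⟨pb.finite, ?_⟩
  rw [pb.finrank, Algebra.adjoin.powerBasis_dim, ← cyclotomic_eq_minpoly_rat hprim (Nat.pos_of_ne_zero hq),
    natDegree_cyclotomic]

/-- The half-system index type is the filtered `Finset`. [folklore] -/
private theorem mem_halfSystem_iff' (q a : ℕ) :
    a ∈ (((range q).filter q.Coprime).filter fun a => 2 * a < q) ↔ 2 * a < q ∧ Nat.Coprime a q := by
  simp only [mem_filter, mem_range]
  constructor
  · rintro ⟨⟨-, h⟩, h2⟩
    exact ⟨h2, h.symm⟩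
  · rintro ⟨h2, h⟩
    exact ⟨⟨by omega, h.symm⟩, h2⟩

/-- For odd `k`, `(2πi)^k` is purely imaginary: `conj ((2πi)^k) = −(2πi)^k`. [folklore] -/
private theorem conj_two_pi_I_pow {k : ℕ} (hk : Odd k) :
    starRingEnd ℂ ((2 * Real.pi * I) ^ k) = -((2 * Real.pi * I) ^ k) := by
  have e2 : starRingEnd ℂ (2 * Real.pi * I) = -(2 * Real.pi * I) := by
    simp only [map_mul, Complex.conj_ofReal, Complex.conj_I, map_ofNat]
    ring
  rw [map_pow, e2, Odd.neg_pow hk]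

/-- For odd `k = 2m+1` and real `t`: `t·i·(2πi)^k = −(−1)^m 2^k π^k t` (a real number). [folklore] -/
private theorem mul_I_mul_two_pi_I_pow (m : ℕ) (t : ℝ) :
    (t : ℂ) * I * (2 * Real.pi * I) ^ (2 * m + 1) =
      ((-((-1 : ℝ) ^ m * 2 ^ (2 * m + 1)) * Real.pi ^ (2 * m + 1) * t : ℝ) : ℂ) := by
  have hI2 : (I : ℂ) ^ 2 = -1 := Complex.I_sq
  have e1 : (2 * Real.pi * I : ℂ) ^ (2 * m + 1) = (2 * Real.pi) ^ (2 * m + 1) * ((-1) ^ m * I) := by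
    rw [mul_pow, pow_succ I, pow_mul, hI2]
  rw [e1]
  push_cast
  linear_combination ((t : ℂ) * (2 * (Real.pi : ℂ)) ^ (2 * m + 1) * (-1) ^ m) * hI2

/-! ### The imaginary part of `ℚ(ζ_q)` is spanned by the `Z_k(a,q)` -/

/-- **«`i√q` lies in the `ℚ`-linear space generated by the `Z_k(a,q)`» — for every purely imaginary element of
`ℚ(ζ_q)`, in real terms**: for odd `k ≥ 3`, `q ≥ 3` and `t ∈ ℝ` with `t·i ∈ ℚ(e^{2πi/q})`,
`π^k · t ∈ V_k^+(q) = Span_ℚ {ζ(k, a/q) + (−1)^k ζ(k, 1 − a/q) : 1 ≤ a < q/2, (a,q) = 1}`.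
Proof: the `φ(q)/2` numbers `Z_k(a,q) = (ζ(k,a/q) − ζ(k,1−a/q))/(2πi)^k ∈ ℚ(ζ_q)` (Proposition 1, the tree's
`hurwitzEven_mem_cyclotomic`) are purely imaginary and `ℚ`-linearly independent (Okada), and the `(−1)`-eigenspace of
conjugation on `ℚ(ζ_q)` has dimension `≤ φ(q)/2`, so it IS their span; multiply by `(2πi)^k = ±2^k π^k i`.
[cite: GunRammurtyRath2011, proof of Proposition 3 (p. 1338) with Proposition 1 (pp. 1332–1334)] -/
theorem pi_pow_mul_mem_span_hurwitzEven_of_mul_I_mem_adjoin {k q : ℕ} (hk : Odd k) (hk2 : 2 ≤ k) (hq : 3 ≤ q)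
    {t : ℝ} (ht : (t : ℂ) * I ∈ Algebra.adjoin ℚ ({Complex.exp (2 * Real.pi * I / q)} : Set ℂ)) :
    Real.pi ^ k * t ∈ Submodule.span ℚ {y : ℝ | ∃ a : ℕ, 1 ≤ a ∧ 2 * a < q ∧ Nat.Coprime a q ∧
        y = hurwitzValue k ((a : ℝ) / q) + (-1 : ℝ) ^ k * hurwitzValue k (1 - (a : ℝ) / q)} := by
  haveI : NeZero q := ⟨by omega⟩
  set K := Algebra.adjoin ℚ ({Complex.exp (2 * Real.pi * I / q)} : Set ℂ) with hK
  set c : ℂ := (2 * Real.pi * I) ^ k with hc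
  have hc0 : c ≠ 0 := pow_ne_zero _ Complex.two_pi_I_ne_zero
  have hcc : starRingEnd ℂ c = -c := conj_two_pi_I_pow hk
  -- the index type of the half-system and the generators
  haveI : Fintype {a : ℕ // 2 * a < q ∧ Nat.Coprime a q} := Fintype.subtype _ (mem_halfSystem_iff' q)
  let y : {a : ℕ // 2 * a < q ∧ Nat.Coprime a q} → ℝ := fun a =>
    hurwitzValue k (((a : ℕ) : ℝ) / q) + (-1 : ℝ) ^ k * hurwitzValue k (1 - ((a : ℕ) : ℝ) / q)
  let z : {a : ℕ // 2 * a < q ∧ Nat.Coprime a q} → ℂ := fun a => ((y a : ℝ) : ℂ) * c⁻¹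
  have ha1 : ∀ a : {a : ℕ // 2 * a < q ∧ Nat.Coprime a q}, 1 ≤ (a : ℕ) := by
    intro a
    rcases Nat.eq_zero_or_pos (a : ℕ) with h | h
    · have := a.2.2; rw [h, Nat.coprime_zero_left] at this; omega
    · exact h
  -- Okada: the `y a` are linearly independent, hence so are the `z a`
  have hliy : LinearIndependent ℚ y := okada_linearIndependent_hurwitzZeta_holds k q hk2 hq
  have hliz : LinearIndependent ℚ z := by
    rw [Fintype.linearIndependent_iff] at hliy ⊢
    intro g hg
    apply hliy
    have h1 : ((∑ a, g a • y a : ℝ) : ℂ) = (∑ a, g a • z a) * c := by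
      push_cast
      rw [Finset.sum_mul]
      refine Finset.sum_congr rfl fun a _ => ?_
      simp only [z, Rat.smul_def]
      field_simp
    rw [hg, zero_mul] at h1
    exact_mod_cast h1
  -- the `z a` lie in `K` (Proposition 1) and are purely imaginary
  have hzK : ∀ a, z a ∈ K := by
    intro a
    obtain ⟨w, hw, e⟩ := hurwitzEven_mem_cyclotomic (q := q) hk2 (by omega) (a := a)
      (by have := a.2.1; omega)
    have : z a = w := by
      simp only [z]
      rw [e, ← hc, mul_comm c w, mul_assoc, mul_inv_cancel₀ hc0, mul_one]
    rw [this]; exact hw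
  have hzconj : ∀ a, starRingEnd ℂ (z a) = -z a := by
    intro a
    simp only [z, map_mul, Complex.conj_ofReal, map_inv₀, hcc, inv_neg, mul_neg]
  -- the (−1)-eigenspace of conjugation on `K`
  let Km : Submodule ℚ ℂ :=
    { carrier := {w | w ∈ K ∧ starRingEnd ℂ w = -w}
      add_mem' := fun {u v} hu hv => ⟨Subalgebra.add_mem _ hu.1 hv.1, by rw [map_add, hu.2, hv.2, neg_add]⟩
      zero_mem' := ⟨Subalgebra.zero_mem _, by simp⟩
      smul_mem' := fun r {w} hw => by
        refine ⟨?_, ?_⟩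
        · rw [Rat.smul_def]
          exact Subalgebra.mul_mem _ (by simpa using Subalgebra.algebraMap_mem K r) hw.1
        · rw [Rat.smul_def, map_mul, map_ratCast, hw.2, mul_neg] }
  have hmemKm : ∀ {w : ℂ}, w ∈ Km ↔ w ∈ K ∧ starRingEnd ℂ w = -w := fun {w} => Iff.rfl
  have hS_le : Submodule.span ℚ (Set.range z) ≤ Km := by
    refine Submodule.span_le.2 ?_
    rintro _ ⟨a, rfl⟩
    exact (hmemKm).2 ⟨hzK a, hzconj a⟩
  -- `K` is finite-dimensional of dimension `φ(q)`; `Km ≤ K`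
  obtain ⟨hKfin, hKrank⟩ := finrank_adjoin_exp (q := q) (by omega)
  rw [← hK] at hKfin hKrank
  let ι₁ : Km →ₗ[ℚ] ↥K :=
    { toFun := fun w => ⟨(w : ℂ), ((hmemKm).1 w.2).1⟩
      map_add' := fun u v => rfl
      map_smul' := fun r w => by
        ext
        simp [Rat.smul_def] }
  have hι₁ : Function.Injective ι₁ := by
    intro u v h
    exact Subtype.ext (congrArg Subtype.val h :)
  haveI : Module.Finite ℚ ↥Km := Module.Finite.of_injective ι₁ hι₁
  -- a non-zero purely imaginary element: `ξ = z 1`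
  let a₀ : {a : ℕ // 2 * a < q ∧ Nat.Coprime a q} := ⟨1, by omega, Nat.coprime_one_left q⟩
  have hy0 : 0 < y a₀ := by
    have hq0 : (0 : ℝ) < q := by exact_mod_cast (show 0 < q by omega)
    have hx : (0 : ℝ) < ((1 : ℕ) : ℝ) / q := by positivity
    have hxy : ((1 : ℕ) : ℝ) / q < 1 - ((1 : ℕ) : ℝ) / q := by
      rw [Nat.cast_one, lt_sub_iff_add_lt, ← two_mul, mul_one_div, div_lt_one hq0]
      exact_mod_cast (show 2 < q by omega)
    have hlt := hurwitzValue_lt_of_lt hx hxy hk2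
    simp only [y, a₀, Odd.neg_one_pow hk]
    linarith
  have hξ0 : z a₀ ≠ 0 := by
    simp only [z]
    exact mul_ne_zero (by exact_mod_cast hy0.ne') (inv_ne_zero hc0)
  -- `(u, v) ↦ u + ξ v` embeds `Km × Km` into `K`, so `2·dim Km ≤ φ(q)`
  let ι₂ : (↥Km × ↥Km) →ₗ[ℚ] ↥K :=
    { toFun := fun p => ⟨(p.1 : ℂ) + z a₀ * (p.2 : ℂ),
        Subalgebra.add_mem _ ((hmemKm).1 p.1.2).1 (Subalgebra.mul_mem _ (hzK a₀) ((hmemKm).1 p.2.2).1)⟩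
      map_add' := fun p p' => by
        ext
        simp only [Prod.fst_add, Prod.snd_add, Submodule.coe_add, Subalgebra.coe_add]
        ring
      map_smul' := fun r p => by
        ext
        simp only [Prod.smul_fst, Prod.smul_snd, Submodule.coe_smul, RingHom.id_apply, Subalgebra.coe_smul,
          Rat.smul_def]
        ring }
  have hι₂ : Function.Injective ι₂ := by
    rw [← LinearMap.ker_eq_bot, LinearMap.ker_eq_bot']
    rintro ⟨u, v⟩ h
    have h0 : (u : ℂ) + z a₀ * (v : ℂ) = 0 := congrArg Subtype.val h
    have hu := ((hmemKm).1 u.2).2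
    have hv := ((hmemKm).1 v.2).2
    have h1 : starRingEnd ℂ ((u : ℂ) + z a₀ * (v : ℂ)) = 0 := by rw [h0, map_zero]
    rw [map_add, map_mul, hu, hv, hzconj] at h1
    have hv0 : (v : ℂ) = 0 := by
      have : 2 * (z a₀ * (v : ℂ)) = 0 := by linear_combination h0 + h1
      simpa [hξ0] using this
    have hu0 : (u : ℂ) = 0 := by rw [hv0, mul_zero, add_zero] at h0; exact h0
    ext <;> simp [hu0, hv0]
  have h2 : 2 * Module.finrank ℚ ↥Km ≤ Nat.totient q := by
    have := LinearMap.finrank_le_finrank_of_injective hι₂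
    rw [Module.finrank_prod] at this
    omega
  -- the span of the `z a` has dimension `φ(q)/2`, hence equals `Km`
  have hSrank : Module.finrank ℚ ↥(Submodule.span ℚ (Set.range z)) = Nat.totient q / 2 := by
    rw [finrank_span_eq_card hliz, card_halfSystem hq]
  have hSeq : Submodule.span ℚ (Set.range z) = Km :=
    Submodule.eq_of_le_of_finrank_le hS_le (by omega)
  -- `t·i ∈ Km = span z`
  have htK : (t : ℂ) * I ∈ Km := by
    refine (hmemKm).2 ⟨ht, ?_⟩
    simp only [map_mul, Complex.conj_ofReal, Complex.conj_I, mul_neg]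
  rw [← hSeq, Submodule.mem_span_range_iff_exists_fun] at htK
  obtain ⟨g, hg⟩ := htK
  -- multiply by `(2πi)^k`
  obtain ⟨m, rfl⟩ := hk
  have hreal : ((∑ a, g a • y a : ℝ) : ℂ) =
      ((-((-1 : ℝ) ^ m * 2 ^ (2 * m + 1)) * Real.pi ^ (2 * m + 1) * t : ℝ) : ℂ) := by
    rw [← mul_I_mul_two_pi_I_pow m t, ← hg, ← hc]
    push_cast
    rw [Finset.sum_mul]
    refine Finset.sum_congr rfl fun a _ => ?_
    simp only [z, Rat.smul_def]
    field_simp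
  have hreal' := Complex.ofReal_injective hreal
  have hne : (-((-1 : ℝ) ^ m * 2 ^ (2 * m + 1))) ≠ 0 := by
    apply neg_ne_zero.2; positivity
  have e : Real.pi ^ (2 * m + 1) * t = ((-((-1 : ℚ) ^ m * 2 ^ (2 * m + 1)))⁻¹ : ℚ) • ∑ a, g a • y a := by
    rw [Rat.smul_def, hreal']
    push_cast
    field_simp
  rw [e]
  refine Submodule.smul_mem _ _ (Submodule.sum_mem _ fun a _ => Submodule.smul_mem _ _ ?_)
  exact Submodule.subset_span ⟨a, ha1 a, a.2.1, a.2.2, rfl⟩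

/-! ### The engine of Proposition 3 -/

/-- **Gun–Murty–Rath 2011, Proposition 3 — the engine (contrapositive form, every modulus)**: let `k ≥ 3` be odd,
`q ≥ 3`, `t ∈ ℝ` with `t·i ∈ ℚ(e^{2πi/q})` (for the printed case, `t = √q`), and suppose `ζ(k) = r·π^k·t` with `r ∈ ℚ`.
Then the Chowla–Milnor conjecture is FALSE at `(k, q)`: `dim_ℚ V_k(q) < φ(q)`,
`V_k(q) = Span_ℚ {ζ(k, a/q) : 1 ≤ a < q, (a,q) = 1}`. Indeed the coprime sum `J_k(q)ζ(k) = Σ_{(a,q)=1} ζ(k, a/q)`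
(`J_k(q) > 0`) lies in `V_k^−(q)` (pairing) and in `V_k^+(q)` (`π^k t ∈ V_k^+(q)` by the previous theorem), and is
non-zero — «the Chowla–Milnor conjecture for the modulus `q` implies that `ζ(k)/(2πi)^k` and `i√q` lie in disjoint
`ℚ`-spaces … hence `ζ(2d+1)/(π^{2d+1}√q) ∉ ℚ`». [cite: GunRammurtyRath2011, Proposition 3 and its proof (pp. 1337–1338)] -/
theorem finrank_span_lt_totient_of_zetaValue_eq {k q : ℕ} (hk : Odd k) (hk2 : 2 ≤ k) (hq : 3 ≤ q) {t : ℝ} {r : ℚ}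
    (ht : (t : ℂ) * I ∈ Algebra.adjoin ℚ ({Complex.exp (2 * Real.pi * I / q)} : Set ℂ))
    (hζ : zetaValue k = r * Real.pi ^ k * t) :
    Module.finrank ℚ ↥(Submodule.span ℚ {y : ℝ | ∃ a : ℕ, 1 ≤ a ∧ a < q ∧ Nat.Coprime a q ∧
        y = hurwitzValue k ((a : ℝ) / q)}) < Nat.totient q := by
  set J : ℤ := ∑ d ∈ q.divisors, (ArithmeticFunction.moebius d : ℤ) * ((q / d : ℕ) : ℤ) ^ k with hJ
  have hJpos : 0 < J := jordan_pos (by omega) hk2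
  set C : ℝ := ∑ a ∈ (Finset.Ioc 0 q).filter (fun a => a.Coprime q), hurwitzValue k ((a : ℝ) / q) with hC
  have hCeq : C = (J : ℝ) * zetaValue k := by rw [hC, hJ, sum_coprime_hurwitzValue_eq (by omega) hk2]
  have hC0 : C ≠ 0 := by
    rw [hCeq]
    exact mul_ne_zero (by exact_mod_cast hJpos.ne') (zetaValue_pos_of_two_le hk2).ne'
  have hCodd : C ∈ oddChowlaMilnorSpace k q := sum_coprime_hurwitzValue_mem_oddChowlaMilnorSpace hk hq
  have hCeven : C ∈ Submodule.span ℚ {y : ℝ | ∃ a : ℕ, 1 ≤ a ∧ 2 * a < q ∧ Nat.Coprime a q ∧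
      y = hurwitzValue k ((a : ℝ) / q) + (-1 : ℝ) ^ k * hurwitzValue k (1 - (a : ℝ) / q)} := by
    have hmem := pi_pow_mul_mem_span_hurwitzEven_of_mul_I_mem_adjoin hk hk2 hq ht
    have e : C = ((J : ℚ) * r : ℚ) • (Real.pi ^ k * t) := by
      rw [hCeq, hζ, Rat.smul_def]
      push_cast
      ring
    rw [e]
    exact Submodule.smul_mem _ _ hmem
  exact finrank_span_lt_totient_of_mem_inf hk2 hq hC0 hCeven hCodd

end Literature.NumberTheory.Irrationality.DirichletLValues

end
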